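import Mathlib
import Literature.MathematicalPhysics.QuantumFieldTheory.OSBoostChains
import Literature.MathematicalPhysics.QuantumFieldTheory.PointwiseOSBoostCalculus
import Literature.MathematicalPhysics.QuantumFieldTheory.OSLorentzInvariance
import HarnessLib

/-!
# Boosted cluster configurations of the pointwise OS calculus: geometry of the chains

The geometric half of the analytic continuation of `θ ↦ S(R_θ x)` (`R_θ = planeRot 0 θ`, rotation
about the axis `e₂` of `ℝ³`) in the Osterwalder–Schrader calculus of the time axis `e₀`
(`OSBoostChains`, `PointwiseOSBoostCalculus`): which half-space configuration a chain of shifts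
(`HalfSpaceConfig.shift`) and spin insertions (`HalfSpaceConfig.spinCons`) reaches at a real angle,
and the two facts about these configurations that drive the growth estimate —

* `chainCfg_spec`, `chainCfg_ofFn_eq`, `chainCfg_ofFn_refl_eq`: the chain of the items of points
  `y₁, …, y_m` seen from a virtual rotating reference point `q` reaches the cluster
  `{R_θ (y_j - q)}` (ket blocks) resp. `{θ₀ R_θ (y_j - q)}` at the angle `-θ` for the reflected items
  (bra blocks);
* `osPointKernel_block_rot`, `osPointKernel_block_rot_refl`: rotation invariance of `S_{2m}` makes the
  Gram entries `K(c(θ-s), c(θ+s))` of these clusters independent of `s`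
  (`θ₀ ∘ R_φ = R_{-φ} ∘ θ₀`), the input of the norm identity `inner_self_eq_of_conjOp_eq`;
* `abs_osPointKernel_self_le`: the Gaussian-domination a priori bound controls `K(c, c)`.

Plus the coordinate bookkeeping `itemOf`, `virtOf`, `ChainItem.refl`, `ChainItem.pt`, and
`isChain_cons_ofFn`. References: Glimm–Jaffe, *Quantum Physics* (1987), §19.5–19.7. [folklore]
-/

noncomputable section

open Filter ComplexConjugate Complex
open scoped InnerProductSpace Topology
open Literature.Probability.LatticeModels
open Literature.Analysis.OperatorTheory Literature.Analysis.OperatorTheory.KernelVectors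
  Literature.Analysis.Complex

namespace Literature.MathematicalPhysics.QuantumFieldTheory

open ChainItem

local notation "E³" => EuclideanSpace ℝ (Fin 3)
local notation "e₀" => EuclideanSpace.single (0 : Fin 3) (1 : ℝ)
local notation "e₁" => EuclideanSpace.single (1 : Fin 3) (1 : ℝ)
local notation "e₂" => EuclideanSpace.single (2 : Fin 3) (1 : ℝ)

/-! ## Rotations about `e₂` and the reflection `θ₀` -/

/-- Plane rotations about `e₂` compose additively. [folklore] -/
theorem planeRot_add_apply (φ ψ : ℝ) (y : E³) :
    planeRot (d := 2) 0 (φ + ψ) y = planeRot (d := 2) 0 φ (planeRot (d := 2) 0 ψ y) := by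
  ext i
  fin_cases i <;> simp [planeRot_apply, Real.cos_add, Real.sin_add] <;> ring

/-- **The reflection conjugates a rotation to its inverse**: `θ₀ (R_φ y) = R_{-φ} (θ₀ y)`. [folklore] -/
theorem axisReflection_planeRot (φ : ℝ) (y : E³) :
    axisReflection 0 (planeRot (d := 2) 0 φ y) = planeRot (d := 2) 0 (-φ) (axisReflection 0 y) := by
  ext i
  fin_cases i <;> simp [planeRot_apply]; ring

/-! ## Items of points -/

/-- The (inserted) item of a point of `ℝ³`. [folklore] -/
def itemOf (x : E³) : ChainItem := ⟨x 0, x 1, x 2, true⟩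

/-- The virtual item of a reference point (only its planar part matters). [folklore] -/
def virtOf (q : E³) : ChainItem := ⟨q 0, q 1, 0, false⟩

/-- The item reflected in the mirror `e₀^⊥`. [folklore] -/
def ChainItem.refl (P : ChainItem) : ChainItem := ⟨-P.a, P.b, P.w, P.ins⟩

/-- The point of an item at the real angle `θ`: `(t, s, w)`. [folklore] -/
def ChainItem.pt (P : ChainItem) (θ : ℝ) : E³ := WithLp.toLp 2 ![P.t θ, P.s θ, P.w]

/-- The planar part of the point of an item at the real angle `θ`: `(t, s, 0)`. [folklore] -/
def ChainItem.pl (P : ChainItem) (θ : ℝ) : E³ := WithLp.toLp 2 ![P.t θ, P.s θ, 0]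

/-- The point is the planar part plus the axial component. [folklore] -/
theorem ChainItem.pt_eq_pl_add (P : ChainItem) (θ : ℝ) : P.pt θ = P.pl θ + P.w • e₂ := by
  ext i; fin_cases i <;> simp [ChainItem.pt, ChainItem.pl]

/-- The point of the item of `x` at angle `θ` is the rotated point `R_θ x`. [folklore] -/
theorem itemOf_pt (x : E³) (θ : ℝ) : (itemOf x).pt θ = planeRot (d := 2) 0 θ x := by
  ext i; fin_cases i <;> simp [ChainItem.pt, itemOf, ChainItem.t, ChainItem.s, planeRot_apply]

/-- The time coordinate of the item of `x` is the `e₀`-coordinate of the rotated point. [folklore] -/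
theorem itemOf_t (x : E³) (θ : ℝ) : (itemOf x).t θ = planeRot (d := 2) 0 θ x 0 := by
  simp [itemOf, ChainItem.t]

/-- The planar position of a virtual reference with vanishing axial coordinate. [folklore] -/
theorem virtOf_pl {q : E³} (hq : q 2 = 0) (θ : ℝ) : (virtOf q).pl θ = planeRot (d := 2) 0 θ q := by
  ext i; fin_cases i <;> simp [ChainItem.pl, virtOf, ChainItem.t, ChainItem.s, planeRot_apply, hq]

/-- The time coordinate of a virtual reference. [folklore] -/
theorem virtOf_t (q : E³) (θ : ℝ) : (virtOf q).t θ = planeRot (d := 2) 0 θ q 0 := by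
  simp [virtOf, ChainItem.t, planeRot_apply]

/-- Reflection keeps the reservation. [folklore] -/
@[simp] theorem ChainItem.res_refl (u : ℝ) (P : ChainItem) : res u P.refl = res u P := rfl

/-- Reflection keeps the insertion flag. [folklore] -/
@[simp] theorem ChainItem.refl_ins (P : ChainItem) : P.refl.ins = P.ins := rfl

/-- Reflection keeps the axial coordinate. [folklore] -/
@[simp] theorem ChainItem.refl_w (P : ChainItem) : P.refl.w = P.w := rfl

/-- Reflected items at the opposite angle: time is negated. [folklore] -/
theorem ChainItem.refl_t (P : ChainItem) (θ : ℝ) : P.refl.t (-θ) = -P.t θ := by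
  simp [ChainItem.refl, ChainItem.t, Real.cos_neg, Real.sin_neg]; ring

/-- Reflected items at the opposite angle: transverse coordinate unchanged. [folklore] -/
theorem ChainItem.refl_s (P : ChainItem) (θ : ℝ) : P.refl.s (-θ) = P.s θ := by
  simp [ChainItem.refl, ChainItem.s, Real.cos_neg, Real.sin_neg]

/-- Reflected items at the opposite angle: the point is the mirror image. [folklore] -/
theorem ChainItem.refl_pt (P : ChainItem) (θ : ℝ) : P.refl.pt (-θ) = axisReflection 0 (P.pt θ) := by
  ext i
  fin_cases i <;> simp [ChainItem.pt, ChainItem.refl_t, ChainItem.refl_s]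

/-- Reflected items at the opposite angle: the planar part is the mirror image. [folklore] -/
theorem ChainItem.refl_pl (P : ChainItem) (θ : ℝ) : P.refl.pl (-θ) = axisReflection 0 (P.pl θ) := by
  ext i
  fin_cases i <;> simp [ChainItem.pl, ChainItem.refl_t, ChainItem.refl_s]

/-- Items of points are inserted. [folklore] -/
@[simp] theorem itemOf_ins (x : E³) : (itemOf x).ins = true := rfl

/-- The axial coordinate of the item of a point. [folklore] -/
@[simp] theorem itemOf_w (x : E³) : (itemOf x).w = x 2 := rfl

/-- Virtual references are not inserted. [folklore] -/
@[simp] theorem virtOf_ins (q : E³) : (virtOf q).ins = false := rfl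

/-- The reservation of an item of a point is `u`. [folklore] -/
@[simp] theorem res_itemOf (u : ℝ) (x : E³) : res u (itemOf x) = u := by simp [res]

/-- The reservation of a virtual reference is `0`. [folklore] -/
@[simp] theorem res_virtOf (u : ℝ) (q : E³) : res u (virtOf q) = 0 := by simp [res]

/-- Chains over `Q :: List.ofFn f` from relations between consecutive values. [folklore] -/
theorem isChain_cons_ofFn {α : Type*} {R : α → α → Prop} {m : ℕ} (Q : α) (f : Fin m → α)
    (h0 : ∀ h : 0 < m, R Q (f ⟨0, h⟩))
    (hs : ∀ (i : ℕ) (h : i + 1 < m), R (f ⟨i, by omega⟩) (f ⟨i + 1, h⟩)) :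
    List.IsChain R (Q :: List.ofFn f) := by
  rw [List.isChain_iff_getElem]
  intro i hi
  simp only [List.length_cons, List.length_ofFn] at hi
  cases i with
  | zero => simpa using h0 (by omega)
  | succ k => simpa using hs k (by omega)

/-! ## The configuration reached by an inserted chain -/

/-- **The configuration reached by a chain of inserted items** `L` seen from the reference `Q` at
the real angle `θ` (reserved gaps positive): `|L|` points, the `j`-th being
`pt_θ(L_j) - pl_θ(Q) - res(Q) e₀` — the rotated points relative to the rotating reference. [folklore] -/
theorem chainCfg_spec {u : ℝ} (hu : 0 < u) (θ : ℝ) :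
    ∀ (L : List ChainItem) (Q : ChainItem), (∀ P ∈ L, P.ins = true) →
      List.IsChain (fun Q P => res u Q + res u P < P.t θ - Q.t θ) (Q :: L) →
      ∃ hn : (chainCfg (fun t y b => b.shift t y) (fun w b => b.spinCons hu w) u L Q θ
          (HalfSpaceConfig.empty 3 0)).n = L.length,
        ∀ j : Fin (chainCfg (fun t y b => b.shift t y) (fun w b => b.spinCons hu w) u L Q θ
          (HalfSpaceConfig.empty 3 0)).n,
          (chainCfg (fun t y b => b.shift t y) (fun w b => b.spinCons hu w) u L Q θ
            (HalfSpaceConfig.empty 3 0)).pts j =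
            (L[(j : ℕ)]'(hn ▸ j.isLt)).pt θ - (Q.pl θ + res u Q • e₀)
  | [], Q, _, _ => ⟨rfl, fun j => j.elim0⟩
  | P :: L, Q, hins, hch => by
    obtain ⟨hQP, hrest⟩ := List.isChain_cons_cons.1 hch
    have hP : P.ins = true := hins P (by simp)
    obtain ⟨hn, hpts⟩ := chainCfg_spec hu θ L P (fun P' hP' => hins P' (by simp [hP'])) hrest
    have hresP : res u P = u := by simp [res, hP]
    have ht : 0 ≤ P.t θ - Q.t θ - (res u Q + res u P) := by linarith
    have hcfg : chainCfg (fun t y b => b.shift t y) (fun w b => b.spinCons hu w) u (P :: L) Q θ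
        (HalfSpaceConfig.empty 3 0) =
        ((chainCfg (fun t y b => b.shift t y) (fun w b => b.spinCons hu w) u L P θ
          (HalfSpaceConfig.empty 3 0)).spinCons hu P.w).shift
          (P.t θ - Q.t θ - (res u Q + res u P)) (P.s θ - Q.s θ) := by
      simp only [chainCfg, hP, ↓reduceIte]
    rw [hcfg]
    refine ⟨by simp [hn], ?_⟩
    intro j
    rw [HalfSpaceConfig.shift_pts ht]
    dsimp only
    rw [HalfSpaceConfig.spinCons_pts]
    cases j using Fin.cases with
    | zero =>
      simp only [Fin.cons_zero, Fin.val_zero, List.getElem_cons_zero, ChainItem.pt_eq_pl_add]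
      rw [hresP]
      ext k; fin_cases k <;> simp [ChainItem.pl]; ring
    | succ i =>
      simp only [Fin.cons_succ, Fin.val_succ, List.getElem_cons_succ]
      rw [hpts i, hresP]
      ext k; fin_cases k <;> simp [ChainItem.pl]; ring

/-- **Ket blocks**: the chain of the items of `y₀, …, y_{m-1}` from the virtual reference `q`
(`q₂ = 0`) reaches the rotated relative cluster `{R_θ (y_j - q)}`. [folklore] -/
theorem chainCfg_ofFn_eq {u : ℝ} (hu : 0 < u) (θ : ℝ) {m : ℕ} (ys : Fin m → E³) {q : E³} (hq : q 2 = 0)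
    (hch : List.IsChain (fun Q P => res u Q + res u P < P.t θ - Q.t θ)
      (virtOf q :: List.ofFn fun j => itemOf (ys j)))
    (hinj : Function.Injective fun j => planeRot (d := 2) 0 θ (ys j - q))
    (hpos : ∀ j, 0 < planeRot (d := 2) 0 θ (ys j - q) 0) :
    chainCfg (fun t y b => b.shift t y) (fun w b => b.spinCons hu w) u (List.ofFn fun j => itemOf (ys j))
      (virtOf q) θ (HalfSpaceConfig.empty 3 0) =
      ⟨m, fun j => planeRot (d := 2) 0 θ (ys j - q), hinj, hpos⟩ := by
  obtain ⟨hn, hpts⟩ := chainCfg_spec hu θ (List.ofFn fun j => itemOf (ys j)) (virtOf q)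
    (by simp) hch
  have hn' : (chainCfg (fun t y b => b.shift t y) (fun w b => b.spinCons hu w) u
      (List.ofFn fun j => itemOf (ys j)) (virtOf q) θ (HalfSpaceConfig.empty 3 0)).n = m := by
    rw [hn, List.length_ofFn]
  refine HalfSpaceConfig.ext' (Fin.sigma_eq_of_eq_comp_cast hn' ?_)
  funext j
  dsimp only
  rw [hpts j]
  simp only [Function.comp_apply, List.getElem_ofFn, itemOf_pt, virtOf_pl hq, res_virtOf, zero_smul,
    add_zero, map_sub]
  rfl

/-- **Bra blocks**: the chain of the REFLECTED items of `y₀, …, y_{m-1}` from the reflected virtual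
reference, at the angle `-θ`, reaches the mirror image `{θ₀ R_θ (y_j - q)}`. [folklore] -/
theorem chainCfg_ofFn_refl_eq {u : ℝ} (hu : 0 < u) (θ : ℝ) {m : ℕ} (ys : Fin m → E³) {q : E³}
    (hq : q 2 = 0)
    (hch : List.IsChain (fun Q P => res u Q + res u P < P.t (-θ) - Q.t (-θ))
      ((virtOf q).refl :: List.ofFn fun j => (itemOf (ys j)).refl))
    (hinj : Function.Injective fun j => axisReflection 0 (planeRot (d := 2) 0 θ (ys j - q)))
    (hpos : ∀ j, 0 < axisReflection 0 (planeRot (d := 2) 0 θ (ys j - q)) 0) :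
    chainCfg (fun t y b => b.shift t y) (fun w b => b.spinCons hu w) u
      (List.ofFn fun j => (itemOf (ys j)).refl) (virtOf q).refl (-θ) (HalfSpaceConfig.empty 3 0) =
      ⟨m, fun j => axisReflection 0 (planeRot (d := 2) 0 θ (ys j - q)), hinj, hpos⟩ := by
  obtain ⟨hn, hpts⟩ := chainCfg_spec hu (-θ) (List.ofFn fun j => (itemOf (ys j)).refl) (virtOf q).refl
    (by simp) hch
  have hn' : (chainCfg (fun t y b => b.shift t y) (fun w b => b.spinCons hu w) u
      (List.ofFn fun j => (itemOf (ys j)).refl) (virtOf q).refl (-θ) (HalfSpaceConfig.empty 3 0)).n = m := by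
    rw [hn, List.length_ofFn]
  refine HalfSpaceConfig.ext' (Fin.sigma_eq_of_eq_comp_cast hn' ?_)
  funext j
  dsimp only
  rw [hpts j]
  simp only [Function.comp_apply, List.getElem_ofFn, ChainItem.refl_pt, ChainItem.refl_pl, itemOf_pt,
    virtOf_pl hq, ChainItem.res_refl, res_virtOf, zero_smul, add_zero, map_sub]
  rfl


/-- The reflected item of a point is the item of the reflected point. [folklore] -/
theorem itemOf_refl (x : E³) : (itemOf x).refl = itemOf (axisReflection 0 x) := by
  simp [itemOf, ChainItem.refl]

/-- The reflected virtual reference is the virtual reference of the reflected point. [folklore] -/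
theorem virtOf_refl (q : E³) : (virtOf q).refl = virtOf (axisReflection 0 q) := by
  simp [virtOf, ChainItem.refl]

/-- Shifts compose additively (nonnegative times). [folklore] -/
theorem HalfSpaceConfig.shift_shift {t t' : ℝ} (ht : 0 ≤ t) (ht' : 0 ≤ t') (y y' : ℝ) (b : HalfSpaceConfig 3 0) :
    (b.shift t y).shift t' y' = b.shift (t' + t) (y' + y) := by
  unfold HalfSpaceConfig.shift
  rw [HalfSpaceConfig.translate_translate]
  refine HalfSpaceConfig.translate_congr _ _ _ ?_
  rw [max_eq_left ht, max_eq_left ht', max_eq_left (add_nonneg ht' ht), add_smul, add_smul]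
  abel

/-- **Changing the reference of a chain is a shift**: the configuration of `P :: L` seen from `Q'`
is the one seen from `Q` shifted by the (reserved) gap from `Q'` to `Q`. [folklore] -/
theorem shift_chainCfg_cons {u : ℝ} (hu : 0 < u) (θ : ℝ) (P : ChainItem) (L : List ChainItem)
    (Q Q' : ChainItem) (x : HalfSpaceConfig 3 0)
    (h1 : 0 ≤ P.t θ - Q.t θ - (res u Q + res u P)) (h2 : 0 ≤ Q.t θ - Q'.t θ - (res u Q' - res u Q)) :
    (chainCfg (fun t y b => b.shift t y) (fun w b => b.spinCons hu w) u (P :: L) Q θ x).shift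
        (Q.t θ - Q'.t θ - (res u Q' - res u Q)) (Q.s θ - Q'.s θ) =
      chainCfg (fun t y b => b.shift t y) (fun w b => b.spinCons hu w) u (P :: L) Q' θ x := by
  simp only [chainCfg]
  rw [HalfSpaceConfig.shift_shift h1 (by linarith)]
  congr 1 <;> ring

/-! ## Rotation invariance of the block Gram entries -/

/-- **Ket block Gram entries are rigid**: if `S_{m+m}` is invariant under the rotations about `e₂`,
then for the rotating cluster `c(θ) = {R_θ Y_j}` the Gram entry `K(c(θ - s), c(θ + s))` equals
`K(c(θ), c(θ))`: the doubled configuration `θ₀ c(θ-s) ⊔ c(θ+s)` is the rotation by `s` of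
`θ₀ c(θ) ⊔ c(θ)` (`θ₀ R_φ = R_{-φ} θ₀`). [folklore] -/
theorem osPointKernel_block_rot (S : CorrFamily 3) {m : ℕ}
    (hrot : ∀ (φ : ℝ) (z : Fin (m + m) → E³), S (m + m) (fun i => planeRot (d := 2) 0 φ (z i)) = S (m + m) z)
    (Y : Fin m → E³) (θ s : ℝ) {c₁ c₂ c₃ : HalfSpaceConfig 3 0}
    (h1 : ∃ hinj hpos, c₁ = ⟨m, fun j => planeRot (d := 2) 0 (θ - s) (Y j), hinj, hpos⟩)
    (h2 : ∃ hinj hpos, c₂ = ⟨m, fun j => planeRot (d := 2) 0 (θ + s) (Y j), hinj, hpos⟩)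
    (h3 : ∃ hinj hpos, c₃ = ⟨m, fun j => planeRot (d := 2) 0 θ (Y j), hinj, hpos⟩) :
    osPointKernel S c₁ c₂ = osPointKernel S c₃ c₃ := by
  obtain ⟨_, _, h1⟩ := h1
  obtain ⟨_, _, h2⟩ := h2
  obtain ⟨_, _, h3⟩ := h3
  rw [h1, h2, h3]
  unfold osPointKernel
  dsimp only
  conv_rhs => rw [← hrot s]
  congr 1
  funext i
  refine Fin.addCases (fun j => ?_) (fun j => ?_) i
  · simp only [Fin.append_left, axisReflection_planeRot, ← planeRot_add_apply]
    ring_nf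
  · simp only [Fin.append_right, ← planeRot_add_apply]
    ring_nf

/-- **Mirror-image block Gram entries are rigid**: the same for the clusters `c(θ) = {θ₀ R_θ Y_j}`
(the doubled configuration at `(θ - s, θ + s)` is the rotation by `-s` of the one at `(θ, θ)`). [folklore] -/
theorem osPointKernel_block_rot_refl (S : CorrFamily 3) {m : ℕ}
    (hrot : ∀ (φ : ℝ) (z : Fin (m + m) → E³), S (m + m) (fun i => planeRot (d := 2) 0 φ (z i)) = S (m + m) z)
    (Y : Fin m → E³) (θ s : ℝ) {c₁ c₂ c₃ : HalfSpaceConfig 3 0}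
    (h1 : ∃ hinj hpos, c₁ = ⟨m, fun j => axisReflection 0 (planeRot (d := 2) 0 (θ - s) (Y j)), hinj, hpos⟩)
    (h2 : ∃ hinj hpos, c₂ = ⟨m, fun j => axisReflection 0 (planeRot (d := 2) 0 (θ + s) (Y j)), hinj, hpos⟩)
    (h3 : ∃ hinj hpos, c₃ = ⟨m, fun j => axisReflection 0 (planeRot (d := 2) 0 θ (Y j)), hinj, hpos⟩) :
    osPointKernel S c₁ c₂ = osPointKernel S c₃ c₃ := by
  obtain ⟨_, _, h1⟩ := h1
  obtain ⟨_, _, h2⟩ := h2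
  obtain ⟨_, _, h3⟩ := h3
  rw [h1, h2, h3]
  unfold osPointKernel
  dsimp only
  conv_rhs => rw [← hrot (-s)]
  congr 1
  funext i
  refine Fin.addCases (fun j => ?_) (fun j => ?_) i
  · simp only [Fin.append_left, axisReflection_axisReflection, ← planeRot_add_apply]
    ring_nf
  · simp only [Fin.append_right, axisReflection_planeRot, ← planeRot_add_apply]
    ring_nf

/-! ## The a priori bound on the block norms -/

/-- A coordinate is bounded by the Euclidean norm (the same one-liner exists proof-internally in
unrelated topics, e.g. `RegevPointSet.abs_apply_le_norm`, `OSLocalTube.abs_apply_le_norm`; restated to avoid a cross-topic import). [folklore] -/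
theorem abs_apply_le_norm_fin3 (z : E³) (i : Fin 3) : |z i| ≤ ‖z‖ := by
  have := PiLp.norm_apply_le z i
  rwa [Real.norm_eq_abs] at this

/-- **Gaussian domination bounds the block norms.** If `|S_n x| ≤ C^{n+1} n! r^{-nΔ}` whenever all
pairwise distances of `x` are `≥ r > 0`, then for a half-space configuration `b` with pairwise
distances `≥ r` and heights `≥ r/2`, `|K(b, b)| ≤ C^{2|b|+1} (2|b|)! r^{-2|b|Δ}`. [folklore] -/
theorem abs_osPointKernel_self_le (S : CorrFamily 3) {Δ C : ℝ}
    (hPD : ∀ (n : ℕ) (x : Fin n → E³) (r : ℝ), 0 < r → (∀ i j, i ≠ j → r ≤ ‖x i - x j‖) →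
      |S n x| ≤ C ^ (n + 1) * (n.factorial : ℝ) * r ^ (-(n : ℝ) * Δ))
    (b : HalfSpaceConfig 3 0) {r : ℝ} (hr : 0 < r) (hsep : ∀ i j, i ≠ j → r ≤ ‖b.pts i - b.pts j‖)
    (hheight : ∀ i, r / 2 ≤ b.pts i 0) :
    |osPointKernel S b b| ≤
      C ^ (b.n + b.n + 1) * ((b.n + b.n).factorial : ℝ) * r ^ (-((b.n + b.n : ℕ) : ℝ) * Δ) := by
  unfold osPointKernel
  refine hPD (b.n + b.n) _ r hr fun i j => ?_
  refine Fin.addCases (fun i' => ?_) (fun i' => ?_) i <;>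
    refine Fin.addCases (fun j' => ?_) (fun j' => ?_) j <;> intro hij
  · simp only [Fin.append_left]
    have hne : i' ≠ j' := fun h => hij (by rw [h])
    rw [← map_sub, LinearIsometryEquiv.norm_map]
    exact hsep i' j' hne
  · simp only [Fin.append_left, Fin.append_right]
    refine le_trans ?_ (abs_apply_le_norm_fin3 _ 0)
    have h1 := hheight i'; have h2 := hheight j'
    simp only [PiLp.sub_apply, axisReflection_apply, if_true]
    rw [abs_sub_comm, abs_of_nonneg (by linarith)]
    linarith
  · simp only [Fin.append_left, Fin.append_right]
    refine le_trans ?_ (abs_apply_le_norm_fin3 _ 0)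
    have h1 := hheight i'; have h2 := hheight j'
    simp only [PiLp.sub_apply, axisReflection_apply, if_true]
    rw [abs_of_nonneg (by linarith)]
    linarith
  · simp only [Fin.append_right]
    have hne : i' ≠ j' := fun h => hij (by rw [h])
    exact hsep i' j' hne

end Literature.MathematicalPhysics.QuantumFieldTheory
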